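import Summits.QuantumFields.BalabanUV.Beta.EriceRemainderEnclosureHistoryAutonomyComparisonNonlinearSize

/-!
# EriceRemainderEnclosureHistoryAutonomyComparisonNonlinearSizePin — (E121f) **COMPARISON AT ANY STEEPNESS FOR EVERY BOUNDED ISOTONE EXCESS UNDER THE SIZE∕PIN CONDITION**
# — (E121e) `le_of_small_isotone_excess` with the pin level kept in the price.  `B u = β₀ + Σ_{k<K} L_k·u_k` (`β₀ > 0`, `L ≥ 0`, `L_0 = 0`; profile, range `K`, sizes, loads
# ARBITRARY); `B′ ≥ B` with a modulus, the excess ISOTONE and `≤ Esup` on the box (no modulus ∕ steepness condition).  The only place where (E121e) used `e ≤ β₀∕10` is the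
# price of the variation-route extra `e·h_{n+k+1}²` at the loaded age `k`: `e·(k−1)·h_{n+1+k}² ≤ 1∕10`, and `a_{n+1+k} ≥ a_0 + (n+1+k)·β₀` with `a_0 = 1∕y²` the level of the
# orbit's head.  Hence (**`defect_sizepin_le`**) the extra fits the spare twentieth as soon as `e·(k−1) ≤ (a_0 + (k+1)β₀)∕10`, and the whole induction runs under
# `E(S′y)·(k−1) ≤ (1∕y² + (k+1)β₀)∕10` for `2 ≤ k < K` (**`gauge_step_sizepin`**, **`steps_nonneg_gauge_sizepin`** — with the variation bound), a condition that only improves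
# along the orbit.  Finals: (**`effective_le_sizepin`**) `B(S y) ≤ B′(S′y)` at every pin `y ≤ p` once the condition holds at `p`; (**`le_of_isotone_excess_sizepin`**,
# family-free) `h′ ≤ h` from every such pin; and the two extremes — `Esup ≤ β₀∕10` is (E121e), while (**`le_of_isotone_excess_uv`**) **`10·(K−2)·Esup ≤ 1∕p²`: IN THE
# ULTRAVIOLET EVERY BOUNDED ISOTONE EXCESS COMPARES, from a threshold pin that depends on the range `K` and the bound `Esup` only — NOT on the size `Σ_kL_k` of the memory,
# NOT on the loads** (contrast (E49j)'s small-pin estimate `(Σ_kL_k)·y ≲ β₀`).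

Cell `pub-balaban`, β-function sub-cell, BINDER row D4 «RemainderConst leaves for Bałaban's split» (`HOME/BINDER-OWNERS.md`; owner lineage `b2b-balaban-beta-an4`;
this file by co-owner #2 lineage `b2b-balaban-beta-d4-p2`, generation 99), β-FLOW TEAM duty (1), FREEZE (0) honoured (def-free; imports (E121e); uses (E118a)
`affine_facts`, (E119b) `excess_facts` ∕ `cmp_of_steps_nonneg` ∕ `excess_orbit_antitone`, (E120b) `base_gauge_light`, (E121a) `conf_incr_ge_var`, (E121b)
`exists_base_depth_var` ∕ `var_base`, (E121d) `gauge_step_of_defect`, (E121e) `excess_le_head`, (E49j) `effective_le_of_small_pin`, (E49k) `family_le_of_orbit`, (E39)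
`exists_memFlow_zm`, (E43b) `memFlow_unique_of_monotone_zm`, (E48a) `family_mem` ∕ `family_zero` ∕ `strictAnti_of_memFlow`, node U2's `invSq_eq_of_memFlow` ∕
`mul_lower_le_drive` BY NAME; the proofs are (E121b §3)∕(E121e)'s re-run with the pin level kept — nothing else restated).

HONEST FRAMING (page 1, verbatim and binding).  *"Discharging BetaPertH makes Bałaban's UV stability UNCONDITIONAL — a real constructive-QFT result; it is
NOT the continuum limit and NOT the Clay problem."*  THIS FILE DISCHARGES NOTHING OF THE KIND.  Elementary real analysis about ABSTRACT functionals on a box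
]0,γ]^ℕ with displayed floors, moduli, profiles and signs — hypotheses of a census, not facts; the form, signs, ages and moments of Bałaban's (1.22) limit
functional are NOT PRINTED ([I] p. 298; GAPS G-t4-U2-1∕-2) and NOT asserted.  Row D4 class UNCHANGED (critical-path width 0; instance 0∕1; D4 DISCHARGE NO
DATE).  HONEST DEPENDENCY: continuum YM on T⁴ ⇐ BetaPertH ∧ nine spine estimates (0/9 proved); BetaPertH ⇐ (D1) ∧ (D4) ∧ CAP+tail; G-an2-4 gates asym, D1
and NE2/3/4.  NOT CLAIMED: large steep excesses crossing inside a heavy row above the threshold pin, Markov weight `L_0 > 0`, anything printed — NOT B12 Thm 2,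
NOT BetaPertH, NOT continuum, NOT Clay.

WHAT IS PROVED ([folklore]; 0 `def`, 0 sorry).  §1 **`defect_sizepin_le`**, **`gauge_step_sizepin`**.  §2 **`steps_nonneg_gauge_sizepin`**.  §3 **`effective_le_sizepin`**,
**`le_of_isotone_excess_sizepin`**, **`le_of_isotone_excess_uv`**.
-/

noncomputable section
open Finset Set

namespace Summit.QuantumFields.BalabanUV.Beta.EriceRemainderEnclosureHistoryAutonomyComparisonNonlinearSizePin

open Literature.MathematicalPhysics.QuantumFieldTheory.Balaban1983to89
open Literature.MathematicalPhysics.QuantumFieldTheory.Balaban1983to89.T4BetaStationary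
open Literature.MathematicalPhysics.QuantumFieldTheory.Balaban1983to89.T4BetaFlowWellPosed
open Summit.QuantumFields.BalabanUV.Beta.EriceRemainderEnclosureHistoryAutonomyOrder (family_mem family_zero le_of_pin_le strictAnti_of_memFlow)
open Summit.QuantumFields.BalabanUV.Beta.EriceRemainderEnclosureHistoryAutonomyComparisonExcess (effective_le_of_small_pin)
open Summit.QuantumFields.BalabanUV.Beta.EriceRemainderEnclosureHistoryAutonomyComparisonIsotoneExcess (family_le_of_orbit)
open Summit.QuantumFields.BalabanUV.Beta.EriceRemainderEnclosureHistoryAutonomyExistence (exists_memFlow_zm)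
open Summit.QuantumFields.BalabanUV.Beta.EriceRemainderEnclosureHistoryAutonomyMonotoneGeneral (memFlow_unique_of_monotone_zm)
open Summit.QuantumFields.BalabanUV.Beta.EriceRemainderEnclosureHistoryAutonomyComparisonNonlinearRowPrep (affine_facts)
open Summit.QuantumFields.BalabanUV.Beta.EriceRemainderEnclosureHistoryAutonomyComparisonNonlinearModulusPrep
  (excess_facts cmp_of_steps_nonneg excess_orbit_antitone)
open Summit.QuantumFields.BalabanUV.Beta.EriceRemainderEnclosureHistoryAutonomyComparisonNonlinearLightBase (base_gauge_light)
open Summit.QuantumFields.BalabanUV.Beta.EriceRemainderEnclosureHistoryAutonomyComparisonNonlinearVariationPrep (conf_incr_ge_var)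
open Summit.QuantumFields.BalabanUV.Beta.EriceRemainderEnclosureHistoryAutonomyComparisonNonlinearVariationBase (exists_base_depth_var var_base)
open Summit.QuantumFields.BalabanUV.Beta.EriceRemainderEnclosureHistoryAutonomyComparisonNonlinearGaugeDefect (gauge_step_of_defect)
open Summit.QuantumFields.BalabanUV.Beta.EriceRemainderEnclosureHistoryAutonomyComparisonNonlinearSize (excess_le_head)

variable {B B' : (ℕ → ℝ) → ℝ} {γ β₀ M' : ℝ} {L : ℕ → ℝ} {K : ℕ} {S S' : ℝ → ℕ → ℝ}

/-! ## §1 The price with the pin level kept; the step -/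

/-- **THE SIZE DEFECT AT AN AGE `k ≥ 1` IS AT MOST A TWENTIETH OF ITS SHARE, when `e·(k−1) ≤ (a_0 + (k+1)β₀)∕10`** (`a_0 = 1∕y²` the level of the orbit's
head): along a box solution `h` of a memory with floor `β₀` from the pin `y`, with the interior window bounded through the gauge (`0 ≤ S ≤ ε1·h_{n+1}²·Σ_{1≤l<k} a_{n+1+l}`,
`ε1 ≥ 0`), `(L_kh_{n+1+k}³∕2)·(e·h_{n+k+1}²)·S ≤ (1∕20)·L_kh_{n+1+k}·h_{n+1}²·ε1` — every window level is `≤ a_{n+1+k}` and `a_{n+1+k} ≥ a_0 + (n+1+k)·β₀`; (E121b)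
`defect_size_le` is the case `e ≤ β₀∕10`, and `e·(K−2) ≤ a_0∕10` (a small PIN) is the other extreme. [folklore] -/
theorem defect_sizepin_le {h : ℕ → ℝ} {y e : ℝ} (hL : ∀ k, 0 ≤ L k) (hβ : 0 < β₀) (hlo : ∀ u, SeqBox γ u → β₀ ≤ B u)
    (hh : SeqBox γ h) (hf : MemFlow B y h) (hy : 0 < y) (he0 : 0 ≤ e) {k : ℕ} (he : e * ((k : ℝ) - 1) ≤ (1 / y ^ 2 + ((k : ℝ) + 1) * β₀) / 10)
    (n : ℕ) (hk : 1 ≤ k) {S ε1 : ℝ} (hε1 : 0 ≤ ε1) (hS : S ≤ ε1 * h (n + 1) ^ 2 * ∑ l ∈ Ico 1 k, 1 / h (n + 1 + l) ^ 2) :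
    L k * h (n + 1 + k) ^ 3 / 2 * (e * h (n + k + 1) ^ 2) * S ≤ 1 / 20 * (L k * h (n + 1 + k) * h (n + 1) ^ 2 * ε1) := by
  have hpos : ∀ j, 0 < h j := fun j => (hh j).1
  have hanti := (strictAnti_of_memFlow hβ hlo hh hf).antitone
  have hx := hpos (n + 1 + k)
  rw [show n + k + 1 = n + 1 + k by ring]
  -- the level at n+1+k is at least a_0 + (n+1+k) β₀ ≥ a_0 + (k+1) β₀
  have hlev : 1 / y ^ 2 + ((n + 1 + k : ℕ) : ℝ) * β₀ ≤ 1 / h (n + 1 + k) ^ 2 := by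
    rw [invSq_eq_of_memFlow hf (n + 1 + k)]
    have := mul_lower_le_drive hlo hh (n + 1 + k)
    linarith
  set A : ℝ := 1 / y ^ 2 + ((k : ℝ) + 1) * β₀ with hA
  have hA0 : 0 < A := by have : 0 < 1 / y ^ 2 := by positivity
                         rw [hA]; positivity
  have hkm1 : A ≤ 1 / h (n + 1 + k) ^ 2 := by
    have : ((k : ℝ) + 1) * β₀ ≤ ((n + 1 + k : ℕ) : ℝ) * β₀ := by
      apply mul_le_mul_of_nonneg_right _ hβ.le; push_cast; linarith
    rw [hA]; linarith
  -- the window: Σ_{l<k} a_{n+1+l} ≤ (k−1) a_{n+1+k}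
  have hwin : ∑ l ∈ Ico 1 k, 1 / h (n + 1 + l) ^ 2 ≤ ((k : ℝ) - 1) * (1 / h (n + 1 + k) ^ 2) := by
    calc ∑ l ∈ Ico 1 k, 1 / h (n + 1 + l) ^ 2 ≤ ∑ l ∈ Ico 1 k, 1 / h (n + 1 + k) ^ 2 :=
          sum_le_sum fun l hl => one_div_le_one_div_of_le (pow_pos hx 2)
            (pow_le_pow_left₀ hx.le (hanti (by have := (mem_Ico.mp hl).2; omega)) 2)
      _ = ((k : ℝ) - 1) * (1 / h (n + 1 + k) ^ 2) := by
          rw [sum_const, Nat.card_Ico, nsmul_eq_mul]; push_cast [hk]; ring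
  have hS' : S ≤ ε1 * h (n + 1) ^ 2 * (((k : ℝ) - 1) * (1 / h (n + 1 + k) ^ 2)) :=
    hS.trans (mul_le_mul_of_nonneg_left hwin (by positivity))
  have hx2 : 0 < h (n + 1 + k) ^ 2 := pow_pos hx 2
  have hkey : e * (((k : ℝ) - 1) * h (n + 1 + k) ^ 2) ≤ 1 / 10 := by
    have h1 : h (n + 1 + k) ^ 2 ≤ 1 / A := by
      rw [le_div_iff₀ hA0]
      have := mul_le_mul_of_nonneg_right hkm1 hx2.le
      rw [one_div_mul_cancel hx2.ne'] at this
      linarith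
    have hk1' : 0 ≤ (k : ℝ) - 1 := by have : (1 : ℝ) ≤ k := by exact_mod_cast hk
                                      linarith
    calc e * (((k : ℝ) - 1) * h (n + 1 + k) ^ 2) ≤ e * (((k : ℝ) - 1) * (1 / A)) :=
          mul_le_mul_of_nonneg_left (mul_le_mul_of_nonneg_left h1 hk1') he0
      _ = e * ((k : ℝ) - 1) / A := by ring
      _ ≤ A / 10 / A := div_le_div_of_nonneg_right he hA0.le
      _ = 1 / 10 := by field_simp
  have hLh : 0 ≤ L k * h (n + 1 + k) := mul_nonneg (hL k) hx.le
  calc L k * h (n + 1 + k) ^ 3 / 2 * (e * h (n + 1 + k) ^ 2) * S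
      ≤ L k * h (n + 1 + k) ^ 3 / 2 * (e * h (n + 1 + k) ^ 2) * (ε1 * h (n + 1) ^ 2 * (((k : ℝ) - 1) * (1 / h (n + 1 + k) ^ 2))) := by
        have hLk := hL k
        exact mul_le_mul_of_nonneg_left hS' (by positivity)
    _ = (L k * h (n + 1 + k) * h (n + 1) ^ 2 * ε1) * (e * (((k : ℝ) - 1) * h (n + 1 + k) ^ 2)) / 2 := by
        have hc : h (n + 1 + k) ^ 2 * (1 / h (n + 1 + k) ^ 2) = 1 := mul_one_div_cancel hx2.ne'
        linear_combination (L k * h (n + 1 + k) ^ 3 / 2 * e * ε1 * h (n + 1) ^ 2 * ((k : ℝ) - 1)) * hc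
    _ ≤ (L k * h (n + 1 + k) * h (n + 1) ^ 2 * ε1) * (1 / 10) / 2 := by
        apply div_le_div_of_nonneg_right _ (by norm_num)
        exact mul_le_mul_of_nonneg_left hkey (by positivity)
    _ = 1 / 20 * (L k * h (n + 1 + k) * h (n + 1) ^ 2 * ε1) := by ring

set_option maxHeartbeats 800000 in
/-- **THE STEP OF THE ROW INDUCTION (isotone excess under the size∕pin condition at the orbit's head, any steepness).**  If `X_m ≥ 0` and `G_{m+1} ≤ G_m` for `m ≥ n+1`, and the variation bound
`Σ_{j<J} h_{m+j}²·Δe_{m+j} ≤ G_m` holds for `m ≥ n+2` and every `J`, then `G_{n+1} + (e_n − e_{n+1})·h_n² ≤ G_n` ((E121d) `gauge_step_of_defect` with (E121a)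
`conf_incr_ge_var` and `defect_sizepin_le`). [folklore] -/
theorem gauge_step_sizepin (hBaff : ∀ u, SeqBox γ u → B u = β₀ + ∑ k ∈ range K, L k * u k) (hL : ∀ k, 0 ≤ L k) (hL0 : L 0 = 0) (hβ : 0 < β₀)
    (hB' : ∀ u u' : ℕ → ℝ, SeqBox γ u → SeqBox γ u' → ∀ D : ℝ, (∀ j, |u j - u' j| ≤ D) → |B' u - B' u'| ≤ M' * D) (hM' : 0 ≤ M')
    (hexc : ∀ u, SeqBox γ u → B u ≤ B' u)
    (hDmono : ∀ u v : ℕ → ℝ, SeqBox γ u → SeqBox γ v → (∀ j, u j ≤ v j) → B' u - B u ≤ B' v - B v)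
    (hS : ∀ p, 0 < p → p ≤ γ → SeqBox γ (S p) ∧ MemFlow B p (S p))
    (huniq : ∀ p, 0 < p → p ≤ γ → ∀ u u' : ℕ → ℝ, SeqBox γ u → SeqBox γ u' → MemFlow B p u → MemFlow B p u' → u = u')
    (hS' : ∀ p, 0 < p → p ≤ γ → SeqBox γ (S' p) ∧ MemFlow B' p (S' p))
    (huniq' : ∀ p, 0 < p → p ≤ γ → ∀ u u' : ℕ → ℝ, SeqBox γ u → SeqBox γ u' → MemFlow B' p u → MemFlow B' p u' → u = u')
    {y : ℝ} (hy : 0 < y) (hyγ : y ≤ γ) (hEsize : ∀ k, 2 ≤ k → k < K → (B' (S' y) - B (S' y)) * ((k : ℝ) - 1) ≤ (1 / y ^ 2 + ((k : ℝ) + 1) * β₀) / 10) (n : ℕ)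
    (hX : ∀ m, n + 1 ≤ m → 0 ≤ B' (S' (S y m)) - B (S (S y m)))
    (hg : ∀ m, n + 1 ≤ m → (B' (S' (S y (m + 1))) - B (S (S y (m + 1)))) * S y (m + 1) ^ 2 ≤ (B' (S' (S y m)) - B (S (S y m))) * S y m ^ 2)
    (hV : ∀ m, n + 2 ≤ m → ∀ J, ∑ j ∈ range J, S y (m + j) ^ 2
        * ((B' (S' (S y (m + j))) - B (S' (S y (m + j)))) - (B' (S' (S y (m + j + 1))) - B (S' (S y (m + j + 1)))))
        ≤ (B' (S' (S y m)) - B (S (S y m))) * S y m ^ 2) :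
    (B' (S' (S y (n + 1))) - B (S (S y (n + 1)))) * S y (n + 1) ^ 2
        + ((B' (S' (S y n)) - B (S' (S y n))) - (B' (S' (S y (n + 1))) - B (S' (S y (n + 1))))) * S y n ^ 2
      ≤ (B' (S' (S y n)) - B (S (S y n))) * S y n ^ 2 := by
  obtain ⟨hmono, hlo, _, _⟩ := affine_facts hBaff hL hβ
  have hh := (hS y hy hyγ).1
  have hf := (hS y hy hyγ).2
  have hpos : ∀ j, 0 < S y j := fun j => (hh j).1
  have hcmp := cmp_of_steps_nonneg hBaff hL hβ hB' hM' hexc hDmono hS huniq hS' huniq' hy hyγ n hX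
  set e : ℕ → ℝ := fun i => B' (S' (S y i)) - B (S' (S y i)) with he_def
  have he := fun i => excess_le_head hBaff hL hβ hB' hM' hexc hDmono hS hS' huniq' hy hyγ i
  -- the defect data
  set ξ : ℕ → ℝ := fun k => e (n + k + 1) * S y (n + k + 1) ^ 2 with hξ_def
  set θ : ℕ → ℝ := fun k => ∑ q ∈ Ico 1 K, L q * S y (n + k + 1 + q) ^ 3 / 2 + ξ k with hθ_def
  have hθ0 : ∀ k, 0 ≤ θ k := fun k => by
    have h1 : 0 ≤ ∑ q ∈ Ico 1 K, L q * S y (n + k + 1 + q) ^ 3 / 2 :=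
      sum_nonneg fun q _ => by have := hL q; have := hpos (n + k + 1 + q); positivity
    have h2 : 0 ≤ ξ k := mul_nonneg (he (n + k + 1)).1 (sq_nonneg _)
    simp only [hθ_def]; linarith
  have hdef : ∀ j, j + 1 < K → (1 / S' (S y (n + 1)) j ^ 2 - 1 / S y (n + 1 + j) ^ 2)
      - (1 / S' (S y (n + 1)) (j + 1) ^ 2 - 1 / S y (n + 1 + j + 1) ^ 2)
      ≤ θ (j + 1) * (1 / S' (S y (n + 1)) j ^ 2 - 1 / S y (n + 1 + j) ^ 2) := by
    intro j _
    have h := conf_incr_ge_var hBaff hL hL0 hβ hB' hM' hexc hDmono hS huniq hS' huniq' hy hyγ (n + 1) j (hcmp (n + 1) (by omega))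
      (hcmp (n + 1 + 1 + j) (by omega)) (hV (n + 1 + 1 + j) (by omega))
    rw [show n + 1 + 1 + j = n + (j + 1) + 1 by ring] at h
    exact h
  have hθle : ∀ k, 2 ≤ k → k < K → θ k ≤ ∑ q ∈ Ico 1 K, L q * S y (n + k + 1 + q) ^ 3 / 2 + ξ k := fun k _ _ => le_rfl
  have hprice : ∀ k, 2 ≤ k → k < K → ∀ W : ℝ, 0 ≤ W →
      W ≤ (B' (S' (S y (n + 1))) - B (S (S y (n + 1)))) * S y (n + 1) ^ 2 * ∑ l ∈ Ico 1 k, 1 / S y (n + 1 + l) ^ 2 →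
      L k * S y (n + 1 + k) ^ 3 / 2 * ξ k * W ≤ 1 / 20 * (L k * S y (n + 1 + k) * S y (n + 1) ^ 2 * (B' (S' (S y (n + 1))) - B (S (S y (n + 1))))) := by
    intro k hk2 hkK W _ hW
    have hk' : 0 ≤ (k : ℝ) - 1 := by have : (2 : ℝ) ≤ k := by exact_mod_cast hk2
                                     linarith
    have hek : (B' (S' (S y (n + k + 1))) - B (S' (S y (n + k + 1)))) * ((k : ℝ) - 1) ≤ (1 / y ^ 2 + ((k : ℝ) + 1) * β₀) / 10 :=
      (mul_le_mul_of_nonneg_right (he (n + k + 1)).2 hk').trans (hEsize k hk2 hkK)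
    exact defect_sizepin_le (B := B) (L := L) hL hβ hlo hh hf hy (he (n + k + 1)).1 hek n (by omega) (hX (n + 1) le_rfl) hW
  exact gauge_step_of_defect hBaff hL hβ hB' hM' hexc hDmono hS huniq hS' huniq' hy hyγ n hX hg hθ0 hdef hθle hprice

/-! ## §2 The nonlinear level gauge and the variation bound along every orbit -/

/-- **THE NONLINEAR LEVEL GAUGE UNDER THE SIZE∕PIN CONDITION.**  Base affine (any profile, range, size; `L_0 = 0`); `B′ ≥ B` with modulus `M′`, isotone excess with
`E(S′y)·(k−1) ≤ (1∕y² + (k+1)β₀)∕10` for `2 ≤ k < K`; unique solution families.  Along the base orbit `h = S y`: at EVERY depth `m`, `X_m ≥ 0`, `X_{m+1}h_{m+1}² ≤ X_mh_m²`, and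
`Σ_{j<J} h_{m+j}²·(e_{m+j} − e_{m+j+1}) ≤ X_mh_m²` for every `J` (row induction from the deep region of (E121b) `exists_base_depth_var`). [folklore] -/
theorem steps_nonneg_gauge_sizepin (hBaff : ∀ u, SeqBox γ u → B u = β₀ + ∑ k ∈ range K, L k * u k) (hL : ∀ k, 0 ≤ L k) (hL0 : L 0 = 0) (hβ : 0 < β₀)
    (hB' : ∀ u u' : ℕ → ℝ, SeqBox γ u → SeqBox γ u' → ∀ D : ℝ, (∀ j, |u j - u' j| ≤ D) → |B' u - B' u'| ≤ M' * D) (hM' : 0 ≤ M')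
    (hexc : ∀ u, SeqBox γ u → B u ≤ B' u)
    (hDmono : ∀ u v : ℕ → ℝ, SeqBox γ u → SeqBox γ v → (∀ j, u j ≤ v j) → B' u - B u ≤ B' v - B v)
    (hS : ∀ p, 0 < p → p ≤ γ → SeqBox γ (S p) ∧ MemFlow B p (S p))
    (huniq : ∀ p, 0 < p → p ≤ γ → ∀ u u' : ℕ → ℝ, SeqBox γ u → SeqBox γ u' → MemFlow B p u → MemFlow B p u' → u = u')
    (hS' : ∀ p, 0 < p → p ≤ γ → SeqBox γ (S' p) ∧ MemFlow B' p (S' p))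
    (huniq' : ∀ p, 0 < p → p ≤ γ → ∀ u u' : ℕ → ℝ, SeqBox γ u → SeqBox γ u' → MemFlow B' p u → MemFlow B' p u' → u = u')
    {y : ℝ} (hy : 0 < y) (hyγ : y ≤ γ) (hEsize : ∀ k, 2 ≤ k → k < K → (B' (S' y) - B (S' y)) * ((k : ℝ) - 1) ≤ (1 / y ^ 2 + ((k : ℝ) + 1) * β₀) / 10) :
    ∀ m, 0 ≤ B' (S' (S y m)) - B (S (S y m))
      ∧ (B' (S' (S y (m + 1))) - B (S (S y (m + 1)))) * S y (m + 1) ^ 2 ≤ (B' (S' (S y m)) - B (S (S y m))) * S y m ^ 2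
      ∧ ∀ J, ∑ j ∈ range J, S y (m + j) ^ 2
          * ((B' (S' (S y (m + j))) - B (S' (S y (m + j)))) - (B' (S' (S y (m + j + 1))) - B (S' (S y (m + j + 1)))))
        ≤ (B' (S' (S y m)) - B (S (S y m))) * S y m ^ 2 := by
  obtain ⟨hmono, hlo, hdom, hBmod⟩ := affine_facts hBaff hL hβ
  have hM : 0 ≤ ∑ k ∈ range K, L k := sum_nonneg fun k _ => hL k
  have hh := (hS y hy hyγ).1
  have hf := (hS y hy hyγ).2
  have hpos : ∀ j, 0 < S y j := fun j => (hh j).1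
  -- the deep region
  obtain ⟨N₀, hN₀⟩ := exists_base_depth_var hBaff hL hβ hh hf
  have hXdeep : ∀ m, N₀ ≤ m → 0 ≤ B' (S' (S y m)) - B (S (S y m)) := by
    intro m hm
    have hq := family_mem hS hy hyγ m
    have hsmall := (hN₀ m hm).1.2
    have := effective_le_of_small_pin hBmod hM hβ hlo hexc hDmono hq.1 hq.2 hsmall (hS _ hq.1 hq.2).1 (hS _ hq.1 hq.2).2
      (hS' _ hq.1 hq.2).1 (hS' _ hq.1 hq.2).2
    linarith
  -- P(n): non-negativity, the gauge and the variation bound at every m ≥ n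
  have hP : ∀ d n, N₀ ≤ n + d → ∀ m, n ≤ m → 0 ≤ B' (S' (S y m)) - B (S (S y m))
      ∧ (B' (S' (S y (m + 1))) - B (S (S y (m + 1)))) * S y (m + 1) ^ 2 ≤ (B' (S' (S y m)) - B (S (S y m))) * S y m ^ 2
      ∧ ∀ J, ∑ j ∈ range J, S y (m + j) ^ 2
          * ((B' (S' (S y (m + j))) - B (S' (S y (m + j)))) - (B' (S' (S y (m + j + 1))) - B (S' (S y (m + j + 1)))))
        ≤ (B' (S' (S y m)) - B (S (S y m))) * S y m ^ 2 := by
    intro d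
    induction d with
    | zero =>
      intro n hn m hm
      rw [add_zero] at hn
      have hcmp := cmp_of_steps_nonneg hBaff hL hβ hB' hM' hexc hDmono hS huniq hS' huniq' hy hyγ m fun m' hm' => hXdeep m' (by omega)
      refine ⟨hXdeep m (hn.trans hm), ?_, ?_⟩
      · exact base_gauge_light hBaff hL hL0 hβ hB' hM' hexc hDmono hS huniq hS' huniq' hy hyγ m (hN₀ m (hn.trans hm)).1.1 hcmp
          fun m' hm' => hXdeep m' (by omega)
      · exact var_base hBaff hL hβ hB' hM' hexc hDmono hS huniq hS' huniq' hy hyγ m (hN₀ m (hn.trans hm)).2 hcmp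
    | succ d ih =>
      intro n hn m hm
      have ih' := ih (n + 1) (by omega)
      by_cases hm1 : n + 1 ≤ m
      · exact ih' m hm1
      · have hmn : m = n := by omega
        subst hmn
        have hXb : ∀ m', m + 1 ≤ m' → 0 ≤ B' (S' (S y m')) - B (S (S y m')) := fun m' hm' => (ih' m' hm').1
        have hgb : ∀ m', m + 1 ≤ m' → (B' (S' (S y (m' + 1))) - B (S (S y (m' + 1)))) * S y (m' + 1) ^ 2
            ≤ (B' (S' (S y m')) - B (S (S y m'))) * S y m' ^ 2 := fun m' hm' => (ih' m' hm').2.1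
        have hVb : ∀ m', m + 2 ≤ m' → ∀ J, ∑ j ∈ range J, S y (m' + j) ^ 2
            * ((B' (S' (S y (m' + j))) - B (S' (S y (m' + j)))) - (B' (S' (S y (m' + j + 1))) - B (S' (S y (m' + j + 1)))))
            ≤ (B' (S' (S y m')) - B (S (S y m'))) * S y m' ^ 2 := fun m' hm' => (ih' m' (by omega)).2.2
        have hgs := gauge_step_sizepin hBaff hL hL0 hβ hB' hM' hexc hDmono hS huniq hS' huniq' hy hyγ hEsize m hXb hgb hVb
        have hΔe := (excess_orbit_antitone hBaff hL hβ hB' hM' hexc hDmono hS hS' huniq' hy hyγ m).2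
        have hm2 : 0 < S y m ^ 2 := pow_pos (hpos m) 2
        have hΔe' : 0 ≤ ((B' (S' (S y m)) - B (S' (S y m))) - (B' (S' (S y (m + 1))) - B (S' (S y (m + 1))))) * S y m ^ 2 :=
          mul_nonneg (by linarith) hm2.le
        have hG1 : 0 ≤ (B' (S' (S y (m + 1))) - B (S (S y (m + 1)))) * S y (m + 1) ^ 2 := mul_nonneg (hXb (m + 1) le_rfl) (sq_nonneg _)
        refine ⟨?_, by linarith, ?_⟩
        · have h1 : 0 ≤ (B' (S' (S y m)) - B (S (S y m))) * S y m ^ 2 := by linarith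
          nlinarith
        · intro J
          cases J with
          | zero => simp only [range_zero, sum_empty]; linarith
          | succ J' =>
            rw [sum_range_succ']
            simp only [add_zero]
            have hrest := (ih' (m + 1) le_rfl).2.2 J'
            have e : ∑ j ∈ range J', S y (m + (j + 1)) ^ 2
                * ((B' (S' (S y (m + (j + 1)))) - B (S' (S y (m + (j + 1))))) - (B' (S' (S y (m + (j + 1) + 1))) - B (S' (S y (m + (j + 1) + 1)))))
                = ∑ j ∈ range J', S y (m + 1 + j) ^ 2
                * ((B' (S' (S y (m + 1 + j))) - B (S' (S y (m + 1 + j)))) - (B' (S' (S y (m + 1 + j + 1))) - B (S' (S y (m + 1 + j + 1))))) :=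
              sum_congr rfl fun j _ => by rw [show m + (j + 1) = m + 1 + j by ring]
            rw [e]
            linarith
  intro m
  exact hP N₀ 0 (by omega) m (Nat.zero_le m)

/-! ## §3 Comparison at any steepness for an isotone excess of small size -/

/-- **THE EFFECTIVE β-FUNCTIONS OF `B` AND `B′` ARE ORDERED AT EVERY PIN BELOW `p`**, `B(S y) ≤ B′(S′y)` for `y ∈ ]0,p]` — affine base of any profile and size, isotone
excess of any steepness bounded by `Esup` on the box, with the size∕pin condition `Esup·(k−1) ≤ (1∕p² + (k+1)β₀)∕10` at the loaded ages `2 ≤ k < K` (it only improves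
at deeper pins). [folklore] -/
theorem effective_le_sizepin (hBaff : ∀ u, SeqBox γ u → B u = β₀ + ∑ k ∈ range K, L k * u k) (hL : ∀ k, 0 ≤ L k) (hL0 : L 0 = 0) (hβ : 0 < β₀)
    (hB' : ∀ u u' : ℕ → ℝ, SeqBox γ u → SeqBox γ u' → ∀ D : ℝ, (∀ j, |u j - u' j| ≤ D) → |B' u - B' u'| ≤ M' * D) (hM' : 0 ≤ M')
    (hexc : ∀ u, SeqBox γ u → B u ≤ B' u)
    (hDmono : ∀ u v : ℕ → ℝ, SeqBox γ u → SeqBox γ v → (∀ j, u j ≤ v j) → B' u - B u ≤ B' v - B v)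
    {Esup : ℝ} (hEsup : ∀ u, SeqBox γ u → B' u - B u ≤ Esup) {p : ℝ} (hpγ : p ≤ γ)
    (hpin : ∀ k, 2 ≤ k → k < K → Esup * ((k : ℝ) - 1) ≤ (1 / p ^ 2 + ((k : ℝ) + 1) * β₀) / 10)
    (hS : ∀ p, 0 < p → p ≤ γ → SeqBox γ (S p) ∧ MemFlow B p (S p))
    (huniq : ∀ p, 0 < p → p ≤ γ → ∀ u u' : ℕ → ℝ, SeqBox γ u → SeqBox γ u' → MemFlow B p u → MemFlow B p u' → u = u')
    (hS' : ∀ p, 0 < p → p ≤ γ → SeqBox γ (S' p) ∧ MemFlow B' p (S' p))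
    (huniq' : ∀ p, 0 < p → p ≤ γ → ∀ u u' : ℕ → ℝ, SeqBox γ u → SeqBox γ u' → MemFlow B' p u → MemFlow B' p u' → u = u') :
    ∀ y, 0 < y → y ≤ p → B (S y) ≤ B' (S' y) := by
  intro y hy hyp
  have hyγ : y ≤ γ := hyp.trans hpγ
  have hEy : ∀ k, 2 ≤ k → k < K → (B' (S' y) - B (S' y)) * ((k : ℝ) - 1) ≤ (1 / y ^ 2 + ((k : ℝ) + 1) * β₀) / 10 := by
    intro k hk2 hkK
    have hk' : 0 ≤ (k : ℝ) - 1 := by have : (2 : ℝ) ≤ k := by exact_mod_cast hk2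
                                     linarith
    have h1 : (B' (S' y) - B (S' y)) * ((k : ℝ) - 1) ≤ Esup * ((k : ℝ) - 1) := mul_le_mul_of_nonneg_right (hEsup _ (hS' y hy hyγ).1) hk'
    have h2 : 1 / p ^ 2 ≤ 1 / y ^ 2 := one_div_le_one_div_of_le (pow_pos hy 2) (pow_le_pow_left₀ hy.le hyp 2)
    have h3 := hpin k hk2 hkK
    have : (1 / p ^ 2 + ((k : ℝ) + 1) * β₀) / 10 ≤ (1 / y ^ 2 + ((k : ℝ) + 1) * β₀) / 10 := by linarith
    linarith
  have := (steps_nonneg_gauge_sizepin hBaff hL hL0 hβ hB' hM' hexc hDmono hS huniq hS' huniq' hy hyγ hEy 0).1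
  rw [family_zero hS hy hyγ] at this
  linarith

/-- **COMPARISON AT ANY STEEPNESS FOR EVERY BOUNDED ISOTONE EXCESS UNDER THE SIZE∕PIN CONDITION, family-free form.**  `B u = β₀ + Σ_{k<K} L_k·u_k` on the box ]0,γ]
with `β₀ > 0`, `L ≥ 0`, `L_0 = 0` — profile, range `K`, ALL SIZES ARBITRARY (no light-row condition); `B′ ≥ B` on the box with a modulus `M′ ≥ 0`, the excess `B′ − B`
ISOTONE and `≤ Esup` on the box (no modulus or steepness condition); pin `p ∈ ]0,γ]` with `Esup·(k−1) ≤ (1∕p² + (k+1)β₀)∕10` for `2 ≤ k < K` — e.g. `Esup ≤ β₀∕10`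
((E121e)) OR `10(K−2)·Esup ≤ 1∕p²` (`le_of_isotone_excess_uv`).  Then ANY box solutions `h`, `h′` of `B`, `B′` from `p` satisfy `h′ ≤ h` at EVERY scale. [folklore] -/
theorem le_of_isotone_excess_sizepin {p : ℝ} {h h' : ℕ → ℝ} (hBaff : ∀ u, SeqBox γ u → B u = β₀ + ∑ k ∈ range K, L k * u k) (hL : ∀ k, 0 ≤ L k)
    (hL0 : L 0 = 0) (hβ : 0 < β₀)
    (hB' : ∀ u u' : ℕ → ℝ, SeqBox γ u → SeqBox γ u' → ∀ D : ℝ, (∀ j, |u j - u' j| ≤ D) → |B' u - B' u'| ≤ M' * D) (hM' : 0 ≤ M')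
    (hexc : ∀ u, SeqBox γ u → B u ≤ B' u)
    (hDmono : ∀ u v : ℕ → ℝ, SeqBox γ u → SeqBox γ v → (∀ j, u j ≤ v j) → B' u - B u ≤ B' v - B v)
    {Esup : ℝ} (hEsup : ∀ u, SeqBox γ u → B' u - B u ≤ Esup)
    (hpin : ∀ k, 2 ≤ k → k < K → Esup * ((k : ℝ) - 1) ≤ (1 / p ^ 2 + ((k : ℝ) + 1) * β₀) / 10)
    (hp : 0 < p) (hpγ : p ≤ γ) (hh : SeqBox γ h) (hf : MemFlow B p h) (hh' : SeqBox γ h') (hf' : MemFlow B' p h') (j : ℕ) :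
    h' j ≤ h j := by
  obtain ⟨hmono', hlo'⟩ := excess_facts hBaff hL hβ hexc hDmono
  obtain ⟨hmono, hlo, _, hBmod⟩ := affine_facts hBaff hL hβ
  have hM : 0 ≤ ∑ k ∈ range K, L k := sum_nonneg fun k _ => hL k
  have hγ : 0 < γ := hp.trans_le hpγ
  have hex : ∀ q : ℝ, 0 < q → q ≤ γ → ∃ k : ℕ → ℝ, SeqBox γ k ∧ MemFlow B q k := fun q hq hqγ => exists_memFlow_zm hBmod hM hq hqγ hβ hlo
  have hex' : ∀ q : ℝ, 0 < q → q ≤ γ → ∃ k : ℕ → ℝ, SeqBox γ k ∧ MemFlow B' q k := fun q hq hqγ => exists_memFlow_zm hB' hM' hq hqγ hβ hlo'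
  choose! S hSb hSf using hex
  choose! S' hS'b hS'f using hex'
  have hS : ∀ q, 0 < q → q ≤ γ → SeqBox γ (S q) ∧ MemFlow B q (S q) := fun q hq hqγ => ⟨hSb q hq hqγ, hSf q hq hqγ⟩
  have hS' : ∀ q, 0 < q → q ≤ γ → SeqBox γ (S' q) ∧ MemFlow B' q (S' q) := fun q hq hqγ => ⟨hS'b q hq hqγ, hS'f q hq hqγ⟩
  have huniq : ∀ q, 0 < q → q ≤ γ → ∀ u u' : ℕ → ℝ, SeqBox γ u → SeqBox γ u' → MemFlow B q u → MemFlow B q u' → u = u' :=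
    fun q hq _ u u' hu hu' hfu hfu' => memFlow_unique_of_monotone_zm hmono hBmod hM hq hβ hlo hu hu' hfu hfu'
  have huniq' : ∀ q, 0 < q → q ≤ γ → ∀ u u' : ℕ → ℝ, SeqBox γ u → SeqBox γ u' → MemFlow B' q u → MemFlow B' q u' → u = u' :=
    fun q hq _ u u' hu hu' hfu hfu' => memFlow_unique_of_monotone_zm hmono' hB' hM' hq hβ hlo' hu hu' hfu hfu'
  have e : h = S p := huniq p hp hpγ _ _ hh (hS p hp hpγ).1 hf (hS p hp hpγ).2
  have e' : h' = S' p := huniq' p hp hpγ _ _ hh' (hS' p hp hpγ).1 hf' (hS' p hp hpγ).2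
  rw [e, e']
  have hle : ∀ i, S p i ≤ p := fun i => by
    have := (Summit.QuantumFields.BalabanUV.Beta.EriceRemainderEnclosureHistoryAutonomyOrder.strictAnti_of_memFlow hβ hlo (hS p hp hpγ).1
      (hS p hp hpγ).2).antitone (Nat.zero_le i)
    rwa [family_zero hS hp hpγ] at this
  exact family_le_of_orbit hβ hγ hB' hM' hlo' hS huniq hS' huniq' ⟨hp, hpγ⟩ (fun i _ =>
    effective_le_sizepin hBaff hL hL0 hβ hB' hM' hexc hDmono hEsup hpγ hpin hS huniq hS' huniq' _ (family_mem hS hp hpγ i).1 (hle i)) j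


/-- **COMPARISON IN THE ULTRAVIOLET FOR EVERY BOUNDED ISOTONE EXCESS.**  Same setting; if the pin is small, `10·(K−2)·Esup ≤ 1∕p²` (a threshold independent of the SIZE of
the memory `Σ_kL_k` and of the loads), then ANY box solutions `h`, `h′` of `B`, `B′` from `p` satisfy `h′ ≤ h` at every scale. [folklore] -/
theorem le_of_isotone_excess_uv {p : ℝ} {h h' : ℕ → ℝ} (hBaff : ∀ u, SeqBox γ u → B u = β₀ + ∑ k ∈ range K, L k * u k) (hL : ∀ k, 0 ≤ L k)
    (hL0 : L 0 = 0) (hβ : 0 < β₀)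
    (hB' : ∀ u u' : ℕ → ℝ, SeqBox γ u → SeqBox γ u' → ∀ D : ℝ, (∀ j, |u j - u' j| ≤ D) → |B' u - B' u'| ≤ M' * D) (hM' : 0 ≤ M')
    (hexc : ∀ u, SeqBox γ u → B u ≤ B' u)
    (hDmono : ∀ u v : ℕ → ℝ, SeqBox γ u → SeqBox γ v → (∀ j, u j ≤ v j) → B' u - B u ≤ B' v - B v)
    {Esup : ℝ} (hEsup : ∀ u, SeqBox γ u → B' u - B u ≤ Esup) (hpin : 10 * ((K : ℝ) - 2) * Esup ≤ 1 / p ^ 2)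
    (hp : 0 < p) (hpγ : p ≤ γ) (hh : SeqBox γ h) (hf : MemFlow B p h) (hh' : SeqBox γ h') (hf' : MemFlow B' p h') (j : ℕ) :
    h' j ≤ h j := by
  refine le_of_isotone_excess_sizepin hBaff hL hL0 hβ hB' hM' hexc hDmono hEsup (fun k hk2 hkK => ?_) hp hpγ hh hf hh' hf' j
  have hE0 : 0 ≤ Esup := by have := hEsup _ hh'; linarith [hexc _ hh']
  have hk : (k : ℝ) - 1 ≤ (K : ℝ) - 2 := by
    have : (k : ℝ) + 1 ≤ K := by exact_mod_cast hkK
    linarith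
  have h1 : Esup * ((k : ℝ) - 1) ≤ Esup * ((K : ℝ) - 2) := mul_le_mul_of_nonneg_left hk hE0
  have h2 : 0 ≤ ((k : ℝ) + 1) * β₀ := by positivity
  nlinarith

end Summit.QuantumFields.BalabanUV.Beta.EriceRemainderEnclosureHistoryAutonomyComparisonNonlinearSizePin

end
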